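import Summits.CriticalPhenomena.PercolationContinuityZ3.Theorems.PercNearOneGluingNoHeavyLowerTailAntipodalR1Adjacent
import HarnessLib

/-!
# ANTI₁ across a 2-separation, I: clusters of the glued system seen from one side

Support file for `stmt-CriticalPhenomena-4575` (memo `prim-gen-kcluster/KCLUSTER-gen76.md` §2 / §8 (N4);
conjecture ANTI₁ of `KCLUSTER-gen52.md` §3).  No definitions, no named facts, no sorries.  Vocabulary of
`AntipodalR1` (`nbr`, `clus`; gen 62).

Setting.  A finite multigraph is an edge system `ends : ι → Sym2 V`; a 2-colouring is `x : ι → Bool`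
(`true` = open).  We glue two systems `ends₁ : ι₁ → Sym2 V` ("the side `G₁`") and `ends₂ : ι₂ → Sym2 V`
("the side `G₂`") along a pair of vertices `u, v` (possibly `u = v`): the glued system is
`Sum.elim ends₁ ends₂ : ι₁ ⊕ ι₂ → Sym2 V`.  A vertex `w` is *non-interior* (for `G₂`) when every edge
of `G₂` containing `w` has `w = u ∨ w = v` (written out as `∀ j, w ∈ ends₂ j → w = u ∨ w = v`).  The
separation hypothesis is that every vertex met by an edge of `G₁` is non-interior, and that the apex
`a` is non-interior.

**Cluster correspondence** (`AntipodalR1.mem_clus_iff_red`).  For a colouring `ω` of the glued system,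
a colour `col` and a non-interior vertex `x`:  `x` lies in the `col`-cluster of `a` in the glued system
iff `x` is reachable from `a` by the *reduced adjacency*: an edge of `G₁` of colour `col`, or the jump
`u ↔ v`, the latter allowed iff `u` and `v` are joined by a `col`-coloured path inside `G₂`
(`v ∈ clus ends₂ ω₂ col u`).  Consequently the clusters of the glued system, restricted to non-interior
vertices, depend on the colouring `ω₂` of `G₂` only through the two bits "`u, v` open-joined in `G₂`",
"`u, v` closed-joined in `G₂`" — the *state* of `ω₂` (`AntipodalR1.red_path_iff_of_iff`).  Also: an
interior vertex of `G₂` lies in a cluster of `a` only if `u` or `v` does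
(`AntipodalR1.clus_left_or_right_of_interior`).

These are the path-surgery lemmas behind the 2-cut reduction of ANTI₁ (memo gen76 §2): the sequel
files replace `G₂` by a gadget (no edge / one edge `uv` / an open and a closed edge `uv`) with the same
state, and count.  [this work]
-/

namespace Summit.CriticalPhenomena.PercolationContinuityZ3.Theorems

namespace AntipodalR1

open Relation

variable {V ι ι₁ ι₂ : Type*}

/-- Monotonicity of reachability in the relation (a pointwise form of
`Relation.ReflTransGen.mono`). [this work] -/
theorem path_mono {r p : V → V → Prop} (h : ∀ a b, r a b → p a b) {a b : V}
    (hab : ReflTransGen r a b) : ReflTransGen p a b := by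
  induction hab with
  | refl => exact ReflTransGen.refl
  | tail _ hbc ih => exact ih.tail (h _ _ hbc)

/-- Coloured paths can be reversed. [this work] -/
theorem clus_path_symm {ends : ι → Sym2 V} {x : ι → Bool} {col : Bool} {u v : V}
    (h : ReflTransGen (fun p q => q ∈ nbr ends x col p) u v) :
    ReflTransGen (fun p q => q ∈ nbr ends x col p) v u := by
  induction h with
  | refl => exact ReflTransGen.refl
  | tail _ hbc ih => exact ReflTransGen.head (nbr_symm hbc) ih

/-- Clusters are symmetric: `v ∈ clus_col(u) ↔ u ∈ clus_col(v)`. [this work] -/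
theorem mem_clus_comm {ends : ι → Sym2 V} {x : ι → Bool} {col : Bool} {u v : V} :
    v ∈ clus ends x col u ↔ u ∈ clus ends x col v :=
  ⟨fun h => clus_path_symm h, fun h => clus_path_symm h⟩

/-- Coloured adjacency of a glued system `Sum.elim ends₁ ends₂`: an edge of one side or of the
other. [this work] -/
theorem mem_nbr_sum_elim {ends₁ : ι₁ → Sym2 V} {ends₂ : ι₂ → Sym2 V} {ω : ι₁ ⊕ ι₂ → Bool}
    {col : Bool} {p q : V} :
    q ∈ nbr (Sum.elim ends₁ ends₂) ω col p ↔
      q ∈ nbr ends₁ (fun i => ω (Sum.inl i)) col p ∨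
        q ∈ nbr ends₂ (fun j => ω (Sum.inr j)) col p := by
  constructor
  · rintro ⟨e, he, hends⟩
    cases e with
    | inl i => exact Or.inl ⟨i, he, hends⟩
    | inr j => exact Or.inr ⟨j, he, hends⟩
  · rintro (⟨i, he, hends⟩ | ⟨j, he, hends⟩)
    · exact ⟨Sum.inl i, he, hends⟩
    · exact ⟨Sum.inr j, he, hends⟩

/-- A coloured path of the side `G₁` is a coloured path of the glued system. [this work] -/
theorem clus_path_inl {ends₁ : ι₁ → Sym2 V} {ends₂ : ι₂ → Sym2 V} {ω : ι₁ ⊕ ι₂ → Bool}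
    {col : Bool} {p q : V}
    (h : ReflTransGen (fun p q => q ∈ nbr ends₁ (fun i => ω (Sum.inl i)) col p) p q) :
    ReflTransGen (fun p q => q ∈ nbr (Sum.elim ends₁ ends₂) ω col p) p q :=
  path_mono (fun _ _ h => mem_nbr_sum_elim.2 (Or.inl h)) h

/-- A coloured path of the side `G₂` is a coloured path of the glued system. [this work] -/
theorem clus_path_inr {ends₁ : ι₁ → Sym2 V} {ends₂ : ι₂ → Sym2 V} {ω : ι₁ ⊕ ι₂ → Bool}
    {col : Bool} {p q : V}
    (h : ReflTransGen (fun p q => q ∈ nbr ends₂ (fun j => ω (Sum.inr j)) col p) p q) :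
    ReflTransGen (fun p q => q ∈ nbr (Sum.elim ends₁ ends₂) ω col p) p q :=
  path_mono (fun _ _ h => mem_nbr_sum_elim.2 (Or.inr h)) h

/-- The sub-system `G₁` has smaller clusters than the glued system. [this work] -/
theorem clus_inl_subset {ends₁ : ι₁ → Sym2 V} {ends₂ : ι₂ → Sym2 V} {ω : ι₁ ⊕ ι₂ → Bool}
    {col : Bool} {a : V} :
    clus ends₁ (fun i => ω (Sum.inl i)) col a ⊆ clus (Sum.elim ends₁ ends₂) ω col a :=
  fun _ h => clus_path_inl h

/-- The sub-system `G₂` has smaller clusters than the glued system. [this work] -/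
theorem clus_inr_subset {ends₁ : ι₁ → Sym2 V} {ends₂ : ι₂ → Sym2 V} {ω : ι₁ ⊕ ι₂ → Bool}
    {col : Bool} {a : V} :
    clus ends₂ (fun j => ω (Sum.inr j)) col a ⊆ clus (Sum.elim ends₁ ends₂) ω col a :=
  fun _ h => clus_path_inr h

/-- **Lifting.**  A reduced path from `a` — steps are `col`-edges of `G₁`, or jumps `u ↔ v` allowed
when `J col`, where `J col` implies that `u, v` are `col`-joined inside `G₂` — gives a coloured path of
the glued system. [this work] -/
theorem clus_of_red {ends₁ : ι₁ → Sym2 V} {ends₂ : ι₂ → Sym2 V} {ω : ι₁ ⊕ ι₂ → Bool}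
    {J : Bool → Prop} {u v a x : V} {col : Bool}
    (hJ : J col → v ∈ clus ends₂ (fun j => ω (Sum.inr j)) col u)
    (h : ReflTransGen (fun p q => q ∈ nbr ends₁ (fun i => ω (Sum.inl i)) col p ∨
      (J col ∧ (p = u ∧ q = v ∨ p = v ∧ q = u))) a x) :
    x ∈ clus (Sum.elim ends₁ ends₂) ω col a := by
  rw [mem_clus]
  induction h with
  | refl => exact ReflTransGen.refl
  | tail _ hst ih =>
    rcases hst with hn | ⟨hJc, hpq⟩
    · exact ih.tail (mem_nbr_sum_elim.2 (Or.inl hn))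
    · have huv : ReflTransGen (fun p q => q ∈ nbr (Sum.elim ends₁ ends₂) ω col p) u v :=
        clus_path_inr (hJ hJc)
      rcases hpq with ⟨rfl, rfl⟩ | ⟨rfl, rfl⟩
      · exact ih.trans huv
      · exact ih.trans (clus_path_symm huv)

/-- **Projection.**  Let every vertex met by an edge of `G₁` be non-interior for `G₂`, and let the apex
`a` be non-interior.  Along a coloured path of the glued system from `a`: a non-interior vertex is
reached by a reduced path (jumps `u ↔ v` allowed when `u, v` are `col`-joined inside `G₂`), and an
interior vertex of `G₂` is reached by a reduced path to `u` or `v` followed by a coloured path inside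
`G₂`. [this work] -/
theorem red_of_clus {ends₁ : ι₁ → Sym2 V} {ends₂ : ι₂ → Sym2 V} {ω : ι₁ ⊕ ι₂ → Bool}
    {u v a : V} {col : Bool}
    (hsep : ∀ w i, w ∈ ends₁ i → ∀ j, w ∈ ends₂ j → w = u ∨ w = v)
    (ha : ∀ j, a ∈ ends₂ j → a = u ∨ a = v) {x : V}
    (hx : x ∈ clus (Sum.elim ends₁ ends₂) ω col a) :
    ((∀ j, x ∈ ends₂ j → x = u ∨ x = v) →
      ReflTransGen (fun p q => q ∈ nbr ends₁ (fun i => ω (Sum.inl i)) col p ∨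
        (v ∈ clus ends₂ (fun j => ω (Sum.inr j)) col u ∧ (p = u ∧ q = v ∨ p = v ∧ q = u))) a x) ∧
    (¬ (∀ j, x ∈ ends₂ j → x = u ∨ x = v) → ∃ w, (w = u ∨ w = v) ∧
      ReflTransGen (fun p q => q ∈ nbr ends₁ (fun i => ω (Sum.inl i)) col p ∨
        (v ∈ clus ends₂ (fun j => ω (Sum.inr j)) col u ∧ (p = u ∧ q = v ∨ p = v ∧ q = u))) a w ∧
      x ∈ clus ends₂ (fun j => ω (Sum.inr j)) col w) := by
  rw [mem_clus] at hx
  induction hx with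
  | refl => exact ⟨fun _ => ReflTransGen.refl, fun h => (h ha).elim⟩
  | @tail y z _ hyz ih =>
    rcases mem_nbr_sum_elim.1 hyz with ⟨i, hi, hends⟩ | ⟨j, hj, hends⟩
    · -- an edge of `G₁`: both ends are non-interior
      have hyN : ∀ j, y ∈ ends₂ j → y = u ∨ y = v :=
        hsep y i (by rw [hends]; exact Sym2.mem_mk_left _ _)
      have hzN : ∀ j, z ∈ ends₂ j → z = u ∨ z = v :=
        hsep z i (by rw [hends]; exact Sym2.mem_mk_right _ _)
      exact ⟨fun _ => (ih.1 hyN).tail (Or.inl ⟨i, hi, hends⟩), fun h => (h hzN).elim⟩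
    · -- an edge of `G₂`
      have hzstep : z ∈ nbr ends₂ (fun j => ω (Sum.inr j)) col y := ⟨j, hj, hends⟩
      have hzj : z ∈ ends₂ j := by rw [hends]; exact Sym2.mem_mk_right _ _
      by_cases hyN : ∀ j, y ∈ ends₂ j → y = u ∨ y = v
      · have hy' : y = u ∨ y = v := hyN j (by rw [hends]; exact Sym2.mem_mk_left _ _)
        have hay := ih.1 hyN
        refine ⟨fun hzN => ?_, fun _ => ⟨y, hy', hay, ReflTransGen.single hzstep⟩⟩
        have hz' : z = u ∨ z = v := hzN j hzj
        by_cases hyz' : y = z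
        · rw [← hyz']; exact hay
        · have hJ : v ∈ clus ends₂ (fun j => ω (Sum.inr j)) col u := by
            rcases hy' with rfl | rfl <;> rcases hz' with rfl | rfl
            · exact (hyz' rfl).elim
            · exact ReflTransGen.single hzstep
            · exact clus_path_symm (ReflTransGen.single hzstep)
            · exact (hyz' rfl).elim
          refine hay.tail (Or.inr ⟨hJ, ?_⟩)
          rcases hy' with rfl | rfl <;> rcases hz' with rfl | rfl
          · exact (hyz' rfl).elim
          · exact Or.inl ⟨rfl, rfl⟩
          · exact Or.inr ⟨rfl, rfl⟩
          · exact (hyz' rfl).elim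
      · obtain ⟨w, hw, haw, hyw⟩ := ih.2 hyN
        have hzw : z ∈ clus ends₂ (fun j => ω (Sum.inr j)) col w := clus_step hyw hzstep
        refine ⟨fun hzN => ?_, fun _ => ⟨w, hw, haw, hzw⟩⟩
        have hz' : z = u ∨ z = v := hzN j hzj
        by_cases hwz : w = z
        · rw [← hwz]; exact haw
        · have hJ : v ∈ clus ends₂ (fun j => ω (Sum.inr j)) col u := by
            rcases hw with rfl | rfl <;> rcases hz' with rfl | rfl
            · exact (hwz rfl).elim
            · exact hzw
            · exact clus_path_symm hzw
            · exact (hwz rfl).elim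
          refine haw.tail (Or.inr ⟨hJ, ?_⟩)
          rcases hw with rfl | rfl <;> rcases hz' with rfl | rfl
          · exact (hwz rfl).elim
          · exact Or.inl ⟨rfl, rfl⟩
          · exact Or.inr ⟨rfl, rfl⟩
          · exact (hwz rfl).elim

/-- **Cluster correspondence.**  Under the separation hypothesis and with a non-interior apex, a
non-interior vertex `x` lies in the `col`-cluster of `a` in the glued system iff it is reached from
`a` by the reduced adjacency with jump predicate `J`, for ANY `J` whose bit `J col` is equivalent to
"`u, v` are `col`-joined inside `G₂`". [this work] -/
theorem mem_clus_iff_red {ends₁ : ι₁ → Sym2 V} {ends₂ : ι₂ → Sym2 V} {ω : ι₁ ⊕ ι₂ → Bool}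
    {J : Bool → Prop} {u v a : V} {col : Bool}
    (hsep : ∀ w i, w ∈ ends₁ i → ∀ j, w ∈ ends₂ j → w = u ∨ w = v)
    (ha : ∀ j, a ∈ ends₂ j → a = u ∨ a = v)
    (hJ : J col ↔ v ∈ clus ends₂ (fun j => ω (Sum.inr j)) col u) {x : V}
    (hxN : ∀ j, x ∈ ends₂ j → x = u ∨ x = v) :
    x ∈ clus (Sum.elim ends₁ ends₂) ω col a ↔
      ReflTransGen (fun p q => q ∈ nbr ends₁ (fun i => ω (Sum.inl i)) col p ∨
        (J col ∧ (p = u ∧ q = v ∨ p = v ∧ q = u))) a x := by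
  constructor
  · intro h
    exact path_mono (fun _ _ h => h.imp_right fun h => ⟨hJ.2 h.1, h.2⟩)
      ((red_of_clus hsep ha h).1 hxN)
  · exact clus_of_red hJ.1

/-- An interior vertex of `G₂` lies in the `col`-cluster of `a` only if `u` or `v` does.
[this work] -/
theorem clus_left_or_right_of_interior {ends₁ : ι₁ → Sym2 V} {ends₂ : ι₂ → Sym2 V}
    {ω : ι₁ ⊕ ι₂ → Bool} {u v a : V} {col : Bool}
    (hsep : ∀ w i, w ∈ ends₁ i → ∀ j, w ∈ ends₂ j → w = u ∨ w = v)
    (ha : ∀ j, a ∈ ends₂ j → a = u ∨ a = v) {x : V}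
    (hxI : ¬ ∀ j, x ∈ ends₂ j → x = u ∨ x = v) (hx : x ∈ clus (Sum.elim ends₁ ends₂) ω col a) :
    u ∈ clus (Sum.elim ends₁ ends₂) ω col a ∨ v ∈ clus (Sum.elim ends₁ ends₂) ω col a := by
  obtain ⟨w, hw, haw, -⟩ := (red_of_clus hsep ha hx).2 hxI
  have hw' : w ∈ clus (Sum.elim ends₁ ends₂) ω col a :=
    clus_of_red (J := fun c => v ∈ clus ends₂ (fun j => ω (Sum.inr j)) c u) id haw
  rcases hw with rfl | rfl
  · exact Or.inl hw'
  · exact Or.inr hw'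

/-- **State invariance.**  Two glued systems `G₁ ∪ G₂` and `G₁ ∪ G₂'` along the same pair `{u, v}`,
coloured identically on `G₁` and so that `u, v` are `col`-joined inside `G₂` iff inside `G₂'`, have
the same `col`-cluster of `a` on the vertices that are non-interior for both. [this work] -/
theorem mem_clus_iff_of_sameState {ι₃ : Type*} {ends₁ : ι₁ → Sym2 V} {ends₂ : ι₂ → Sym2 V}
    {ends₃ : ι₃ → Sym2 V} {ω : ι₁ ⊕ ι₂ → Bool} {ω' : ι₁ ⊕ ι₃ → Bool} {u v a : V} {col : Bool}
    (hsep : ∀ w i, w ∈ ends₁ i → ∀ j, w ∈ ends₂ j → w = u ∨ w = v)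
    (hsep' : ∀ w i, w ∈ ends₁ i → ∀ j, w ∈ ends₃ j → w = u ∨ w = v)
    (ha : ∀ j, a ∈ ends₂ j → a = u ∨ a = v) (ha' : ∀ j, a ∈ ends₃ j → a = u ∨ a = v)
    (hω : ∀ i, ω (Sum.inl i) = ω' (Sum.inl i))
    (hst : v ∈ clus ends₂ (fun j => ω (Sum.inr j)) col u ↔
      v ∈ clus ends₃ (fun j => ω' (Sum.inr j)) col u)
    {x : V} (hxN : ∀ j, x ∈ ends₂ j → x = u ∨ x = v) (hxN' : ∀ j, x ∈ ends₃ j → x = u ∨ x = v) :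
    x ∈ clus (Sum.elim ends₁ ends₂) ω col a ↔ x ∈ clus (Sum.elim ends₁ ends₃) ω' col a := by
  have h1 := mem_clus_iff_red (ω := ω) (col := col)
    (J := fun c => v ∈ clus ends₂ (fun j => ω (Sum.inr j)) c u) hsep ha Iff.rfl hxN
  have h2 := mem_clus_iff_red (ω := ω') (col := col)
    (J := fun c => v ∈ clus ends₂ (fun j => ω (Sum.inr j)) c u) hsep' ha' hst hxN'
  rw [h1, h2]
  constructor
  · refine path_mono fun p q h => h.imp_left fun ⟨e, he, hends⟩ => ⟨e, ?_, hends⟩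
    show ω' (Sum.inl e) = col
    rw [← hω e]; exact he
  · refine path_mono fun p q h => h.imp_left fun ⟨e, he, hends⟩ => ⟨e, ?_, hends⟩
    show ω (Sum.inl e) = col
    rw [hω e]; exact he

/-- **The sub-system alone.**  If `u, v` are NOT `col`-joined inside `G₂`, the `col`-cluster of `a` in
the glued system agrees on non-interior vertices with that of `G₁` alone. [this work] -/
theorem mem_clus_iff_inl_of_not_joined {ends₁ : ι₁ → Sym2 V} {ends₂ : ι₂ → Sym2 V}
    {ω : ι₁ ⊕ ι₂ → Bool} {u v a : V} {col : Bool}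
    (hsep : ∀ w i, w ∈ ends₁ i → ∀ j, w ∈ ends₂ j → w = u ∨ w = v)
    (ha : ∀ j, a ∈ ends₂ j → a = u ∨ a = v)
    (hst : v ∉ clus ends₂ (fun j => ω (Sum.inr j)) col u)
    {x : V} (hxN : ∀ j, x ∈ ends₂ j → x = u ∨ x = v) :
    x ∈ clus (Sum.elim ends₁ ends₂) ω col a ↔ x ∈ clus ends₁ (fun i => ω (Sum.inl i)) col a := by
  rw [mem_clus_iff_red (J := fun _ => False) hsep ha ⟨False.elim, fun h => hst h⟩ hxN,
    mem_clus (ends := ends₁)]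
  constructor
  · exact path_mono fun _ _ h => h.elim id fun h => h.1.elim
  · exact path_mono fun _ _ h => Or.inl h

end AntipodalR1

end Summit.CriticalPhenomena.PercolationContinuityZ3.Theorems
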